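import Summits.ABC.IUTFork.Conditional.GenuineKExactTameLocalType
import Summits.ABC.IUTFork.Cor312GenuineKLocalTypeFifteenRatPoint
import Literature.IUT.LogVolume.SubThetaFieldRamificationFifteenOfSqNe
import HarnessLib

/-!
# [IUTchIII] Cor. 3.12, branch C / R-W window table — the EXACT tame local type `e(K_{x₀}/ℚ_p) = 15·l` at a rational point with
# `p ∣ b` (resp. `p ∣ a`) as soon as `√(λ−1) ∉ F` (resp. `√λ ∉ F`) — generator analysis of `IsSubThetaField`, no parity hypothesis

PROOF-ONLY support file (D-0012; 0 definitions, 0 `Prop` facts, no instance) of the abc-iut cell — D-0079 RESCUE sub-cell R-W «WINDOW Θ-SIDE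
INEQUALITY», row «W:FREY73-L19-CONVERSE» = abc-iut-plan ruling C-R89 (a)(ii) «the converse `√(λ−1) ∉ F ⇒ e₇ = 285` as a theorem
(IsSubThetaField generator analysis)», seat abc-iut-L6-t15 (gen 14); file 1/2 (general rational point), file 2/2 =
`Conditional/WRowFrey73NineteenOfNotSquare` (the `73`-triple at `l = 19`). TAKES NO SIDE on [IUTchIII] Cor. 3.12 (S. Mochizuki,
*Inter-universal Teichmüller theory III*, RIMS manuscript, Cor. 3.12 p. 173–174) or on any author: classical algebraic number theory on the
cell's typed Θ-volume data.

CONTEXT. At a TAME pole `p ∉ {2, 3, 5, l}` of `j(λ)` of order `2t`, `gcd(15, t) = 1`, abc-iut-W-neg-2's `GenuineKExactTameLocalType` gives the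
two Kummer candidates `e(K_{x₀}/ℚ_p) ∈ {15·l, 30·l}` and «`√y ∈ F`, `ord_p y` odd ⟹ `30·l`» (`y = λ` at `p ∣ a`, `y = λ − 1` at `p ∣ b`).
The CONVERSE «`√y ∉ F` ⟹ `15·l`» was booked «prose only» (C-R89 (a)). It IS a theorem of the typed datum, by the generator clause of
`Cor22.IsSubThetaField` (`F = F_tpd(S)`, `S ⊆` square roots of `−1, λ, λ−1` LYING IN `F` ∪ `15`-torsion coordinates): a square root absent
from `F` is not a generator, so this seat's Literature lemma `Cor22.ramificationIdx_subThetaField_dvd_fifteen_of_sq_ne` (p499282) bounds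
`e(w | p) ∣ 15` for every place `w ∣ p` of `F` with NO parity hypothesis on `ord_p y`, provided the OTHER radicand is a `p`-unit and `E_λ`
is multiplicative at `p` over `ℚ` (Silverman VII.5.4 (c) Case 2: the tree's `RatPointEven.legendre_hasMultiplicativeReductionAt_of_even`
at `ord_p λ = 0`, resp. `legendre_hasMultiplicativeReductionAt_of_valuation_lt_one` at `|λ|_p < 1`).

WHAT IS PROVED (namespace `Summit.ABC.IUTFork.Conditional`; every input BY NAME):
* §1 **`GenuineK.absRamificationIdx_kOf_dvd_fifteen_mul_ratPoint_of_sq_ne_sub_one`** — `T` a genuine Θ-volume datum at `(ratPoint q, l)`,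
  `p ∉ {2, 3, 5, l}` a pole of `j(q)` with `|q|_p = 1` and `¬ IsSquare (q − 1)` in `T.F` ⟹ at every fibre point `x₀ ∣ p`:
  `e(K_{x₀}/ℚ_p) ∣ 15·l` and `p ∤ e`; **`…_of_sq_ne`** — the twin at `|q|_p < 1` with `¬ IsSquare q` in `T.F`.
* §2 **`GenuineK.absRamificationIdx_kOf_eq_fifteen_mul_of_sq_ne_sub_one`** / **`…_of_sq_ne`** — with the pole order `ord_p j(q) = −2t`,
  `gcd(15, t) = 1`: **`e(K_{x₀}/ℚ_p) = 15·l` EXACTLY** (W-neg-2's dichotomy `{15·l, 30·l}` ∧ `e ∣ 15·l`).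
CONSUMERS (abc-iut-plan C-R94 (d) / C-R95 (d), BY NAME; both radicands are covered): (c = λ − 1, `p ∣ b`) FINDINGS §T.2 — the
`73`-triple `73 + 2¹³·7⁷·941² = 3¹⁶·103³·127` at `l = 19` (file 2/2 `WRowFrey73NineteenOfNotSquare`: «REFUTED iff `√(λ−1) ∉ F`, INHABITED
iff `√(λ−1) ∈ F`» for every genuine datum, with abc-iut-W-neg-2's `…_eq_thirty_mul_of_isSquare` for the other direction); (c = λ, `p ∣ a`)
FINDINGS §T.5 — abc-iut-w5-d009's TYPE-SPLIT segment `821 ≤ l ≤ 1657` of the triple `7¹¹·19 + 5¹²·1019·7151² = 2²⁸·3¹²·11³·67` at the pole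
`7 ∣ a` (`ord_7 λ = 11` odd, `t = 11`, `gcd(15, 11) = 1`, `|λ − 1|_7 = 1`): `…_eq_fifteen_mul_of_sq_ne` reads «`e₇ = 15·l` iff `√λ ∉ F`» there
(the band files inherit the iff reading by name; non-emptiness of either sub-class is NOT claimed here).
HONEST SCOPE: bookkeeping over OUR typed objects; nothing here bears on the printed inequality of [IUTchIII] Cor. 3.12 or on the number-level
`Cor22.Cor312AtDatum`; typed ≠ proved; instantiated ≠ endorsed; no abc claim.
[cite: Mochizuki2012, IUTchI Ex. 3.2 (iv) p. 71; IUTchIV Thm. 1.10 p. 22 and proof Steps (ii)–(iii) p. 24–26, Cor. 2.2 (ii) proof (P5) p. 46]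
[cite: SilvermanAEC2009, proof of Prop. VII.5.4(c), Case 2] [cite: SilvermanATAEC1994, V.4–V.5 and Exercise 5.13 (b)] [cite: SerreLocalFields1979, Ch. IV §2 Cor. 1 of Prop. 7]
[claim: Mochizuki2012, status: disputed] for every IUT quotation.
-/

noncomputable section

open NumberField IsDedekindDomain

namespace Summit.ABC.IUTFork.Conditional

open Thm311 Thm311.Real Cor312 Cor312Prov Literature.IUT.LogVolume Literature.IUT.HodgeTheaters
  Literature.IUT.LogThetaLattice Literature.NumberTheory.NumberFields Literature.NumberTheory.DiophantineGeometry.GenEll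
  Literature.NumberTheory.DiophantineGeometry Literature.NumberTheory.EllipticCurves

/-- `algebraMap (q − 1) = algebraMap q − 1` in the `(ratPoint q).F`-typed form used by the Θ-datum files (plumbing). [folklore] -/
private theorem algebraMap_ratPoint_sub_one {q : ℚ} {l : ℕ} (T : Cor22.ThetaVolumeDatumAt (ratPoint q) l) :
    letI := T.instFieldF; letI := T.instAlgebraF
    algebraMap (ratPoint q).F T.F ((q - 1 : ℚ)) = algebraMap (ratPoint q).F T.F q - 1 := by
  letI := T.instFieldF; letI := T.instAlgebraF
  have h := RingHom.map_sub (algebraMap (ratPoint q).F T.F) q 1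
  rw [map_one] at h
  exact h

/-- From `¬ IsSquare (algebraMap (q − 1))`: no `x ∈ T.F` with `x² = algebraMap q − 1` (the hypothesis shape of this seat's Literature lemma
`Cor22.ThetaVolumeDatumAt.ramificationIdx_int_dvd_fifteen_mul_ratPoint_of_sq_ne`; plumbing). [folklore] -/
private theorem forall_sq_ne_sub_one_of_not_isSquare {q : ℚ} {l : ℕ} (T : Cor22.ThetaVolumeDatumAt (ratPoint q) l)
    (hns : letI := T.instFieldF; letI := T.instAlgebraF; ¬ IsSquare (algebraMap (ratPoint q).F T.F ((q - 1 : ℚ)))) :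
    letI := T.instFieldF; letI := T.instAlgebraF; ∀ x : T.F, x ^ 2 ≠ algebraMap (ratPoint q).F T.F q - 1 := by
  letI := T.instFieldF; letI := T.instAlgebraF
  intro x hx
  exact hns ⟨x, by rw [algebraMap_ratPoint_sub_one T, ← hx, sq]⟩

/-- From `¬ IsSquare (algebraMap q)`: no `x ∈ T.F` with `x² = algebraMap q` (plumbing). [folklore] -/
private theorem forall_sq_ne_of_not_isSquare {q : ℚ} {l : ℕ} (T : Cor22.ThetaVolumeDatumAt (ratPoint q) l)
    (hns : letI := T.instFieldF; letI := T.instAlgebraF; ¬ IsSquare (algebraMap (ratPoint q).F T.F q)) :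
    letI := T.instFieldF; letI := T.instAlgebraF; ∀ x : T.F, x ^ 2 ≠ algebraMap (ratPoint q).F T.F q := by
  letI := T.instFieldF; letI := T.instAlgebraF
  intro x hx
  exact hns ⟨x, by rw [← hx, sq]⟩

/-! ## §1. Fibre forms: `e(K_{x₀}/ℚ_p) ∣ 15·l` at a rational pole with one radicand a `p`-unit and the other WITHOUT a square root in `F` -/

/-- **`p ∣ b` form** (`λ = a/c`, `λ − 1 = −b/c`): for a genuine Θ-volume datum `T` at `(ratPoint q, l)`, a prime `p ∉ {2, 3, 5, l}` with
`ord_p j(q) < 0` and `|q|_p = 1`, and NO `x ∈ T.F` with `x² = q − 1`, EVERY fibre point `x₀ ∣ p` of the `K`-level pilot datum has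
**`e(K_{x₀}/ℚ_p) ∣ 15·l` and `p ∤ e(K_{x₀}/ℚ_p)`**: `E_q` is multiplicative at `p` over `ℚ` (`q ≡ 1`, Silverman VII.5.4 (c) Case 2 — the
tree's `RatPointEven.legendre_hasMultiplicativeReductionAt_of_even` at `ord_p q = 0`), inertia fixes `√−1`, `√q`, and `√(q−1)` is not a
generator of `T.F` (this seat's `Cor22.ThetaVolumeDatumAt.ramificationIdx_int_dvd_fifteen_mul_ratPoint_of_sq_ne`, p499282); NO parity
hypothesis on `ord_p(q − 1)`. [cite: Mochizuki2012, IUTchI Ex. 3.2 (iv) p. 71; IUTchIV Thm. 1.10 p. 22 and proof Steps (ii)–(iii) p. 24–26]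
[cite: SilvermanATAEC1994, V.4–V.5 and Exercise 5.13 (b)] [claim: Mochizuki2012, status: disputed] -/
theorem GenuineK.absRamificationIdx_kOf_dvd_fifteen_mul_ratPoint_of_sq_ne_sub_one {q : ℚ} {l : ℕ}
    (T : Cor22.ThetaVolumeDatumAt (ratPoint q) l)
    (pp : Nat.Primes) (hp2 : (pp : ℕ) ≠ 2) (hp3 : (pp : ℕ) ≠ 3) (hp5 : (pp : ℕ) ≠ 5) (hpl : (pp : ℕ) ≠ l)
    (hpole : ∀ v : HeightOneSpectrum (𝓞 ℚ), Rat.HeightOneSpectrum.natGenerator v = pp →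
      Literature.IUT.LogVolume.ord ℚ v (Cor22.jInv q) < 0)
    (hunit : ∀ v : HeightOneSpectrum (𝓞 ℚ), Rat.HeightOneSpectrum.natGenerator v = pp → v.valuation ℚ q = 1)
    (hns : letI := T.instFieldF; letI := T.instAlgebraF; ¬ IsSquare (algebraMap (ratPoint q).F T.F ((q - 1 : ℚ)))) :
    letI := T.instFieldF; letI := T.instNumberFieldF; letI := T.instAlgebraF; letI := T.instFieldK
    letI := T.instNumberFieldK; letI := T.instAlgebraK; letI := T.instFieldFbar; letI := T.instAlgebraFbar
    letI := T.instAlgebraKFbar; letI := T.instIsElliptic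
    haveI : Fact (pp : ℕ).Prime := ⟨pp.2⟩
    ∀ x₀ : (thetaIndex (pilotDataOfK T.D T.K)).Fibre (.inr pp),
      absRamificationIdx (pp : ℕ) (kOf (pilotDataOfK T.D T.K) pp.1 x₀) ∣ 15 * l ∧
      ¬ (pp : ℕ) ∣ absRamificationIdx (pp : ℕ) (kOf (pilotDataOfK T.D T.K) pp.1 x₀) := by
  -- adapted from abc-iut-w4-d087's `GenuineK.absRamificationIdx_kOf_dvd_fifteen_mul_ratPoint` (Cor312GenuineKLocalTypeFifteenRatPoint.lean)
  letI := T.instFieldF; letI := T.instNumberFieldF; letI := T.instAlgebraF; letI := T.instFieldK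
  letI := T.instNumberFieldK; letI := T.instAlgebraK; letI := T.instFieldFbar; letI := T.instAlgebraFbar
  letI := T.instAlgebraKFbar; letI := T.instIsElliptic
  haveI : Fact (pp : ℕ).Prime := ⟨pp.2⟩
  set X := pilotDataOfK T.D T.K with hXdef
  intro x₀
  set w := placeOf X pp.1 x₀ with hwdef
  have hpw : ((pp : ℕ) : 𝓞 T.K) ∈ w.asIdeal := natCast_mem_placeOf X pp.1 x₀
  have hwchar : residueChar T.K w = (pp : ℕ) := residueChar_eq_of_natCast_mem pp.1 hpw
  -- the norm-defined `e(K_{x₀}/ℚ_p)` is `e(w | p)`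
  have hekOf : absRamificationIdx (pp : ℕ) (kOf X pp.1 x₀) = w.asIdeal.ramificationIdx ℤ := by
    rw [show absRamificationIdx (pp : ℕ) (kOf X pp.1 x₀) =
        absRamificationIdx (pp : ℕ) (RescaledCompletion T.K pp.1 (placeOf X pp.1 x₀) hpw) from rfl,
      absRamificationIdx_rescaledCompletion]
  have hnot : (pp : ℕ) ∉ ({2, 3, 5, l} : Finset ℕ) := by
    simp only [Finset.mem_insert, Finset.mem_singleton, not_or]
    exact ⟨hp2, hp3, hp5, hpl⟩
  -- `ord_p q = 0` is EVEN
  have hev : ∀ v : HeightOneSpectrum (𝓞 ℚ), Rat.HeightOneSpectrum.natGenerator v = pp →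
      ∃ m : ℤ, v.valuation ℚ q = WithZero.exp (2 * m) :=
    fun v hv => ⟨0, by rw [hunit v hv, mul_zero, WithZero.exp_zero]⟩
  -- `q − 1 ≠ 0`: otherwise `0 ∈ T.F` is a square root of `q − 1`
  have hq1 : q - 1 ≠ 0 := by
    intro h
    refine hns ⟨0, ?_⟩
    rw [mul_zero, h]
    exact map_zero _
  have hns' := forall_sq_ne_sub_one_of_not_isSquare T hns
  have hdvd : w.asIdeal.ramificationIdx ℤ ∣ 15 * l :=
    T.ramificationIdx_int_dvd_fifteen_mul_ratPoint_of_sq_ne hnot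
      (fun v hv => by
        obtain ⟨m, hm⟩ := hev v hv
        exact RatPointEven.legendre_hasMultiplicativeReductionAt_of_even v (by rw [hv]; exact hp2) (hpole v hv) hm hq1)
      (Or.inl hev) (Or.inr hns') w hwchar
  rw [hekOf]
  refine ⟨hdvd, fun h => ?_⟩
  -- `p ∤ 15·l` for a prime `p ∉ {2, 3, 5, l}`
  have h' : (pp : ℕ) ∣ 15 * l := h.trans hdvd
  have hl : l.Prime := T.D.l_prime
  rcases (Nat.Prime.dvd_mul pp.2).1 h' with h15 | hll
  · have h15' : (pp : ℕ) ∣ 3 * 5 := by norm_num; exact h15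
    rcases (Nat.Prime.dvd_mul pp.2).1 h15' with h3' | h5'
    · exact hp3 ((Nat.prime_dvd_prime_iff_eq pp.2 Nat.prime_three).1 h3')
    · exact hp5 ((Nat.prime_dvd_prime_iff_eq pp.2 Nat.prime_five).1 h5')
  · exact hpl ((Nat.prime_dvd_prime_iff_eq pp.2 hl).1 hll)

/-- **`p ∣ a` form** (`λ = a/c`): for a genuine Θ-volume datum `T` at `(ratPoint q, l)`, a prime `p ∉ {2, 3, 5, l}` with `|q|_p < 1` (so
`ord_p j(q) < 0` automatically, but we take the pole as a hypothesis in the tree's shape), and NO `x ∈ T.F` with `x² = q`, EVERY fibre point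
`x₀ ∣ p` has **`e(K_{x₀}/ℚ_p) ∣ 15·l` and `p ∤ e(K_{x₀}/ℚ_p)`**: `E_q` is multiplicative at `p` over `ℚ` (`q ≡ 0`, Silverman VII.5.4 (c)
Case 2, the tree's `legendre_hasMultiplicativeReductionAt_of_valuation_lt_one`), `|q − 1|_p = 1` is an even power, and `√q` is not a generator
of `T.F`. [cite: Mochizuki2012, IUTchI Ex. 3.2 (iv) p. 71; IUTchIV Thm. 1.10 p. 22 and proof Steps (ii)–(iii) p. 24–26]
[cite: SilvermanAEC2009, proof of Prop. VII.5.4(c), Case 2] [claim: Mochizuki2012, status: disputed] -/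
theorem GenuineK.absRamificationIdx_kOf_dvd_fifteen_mul_ratPoint_of_sq_ne {q : ℚ} {l : ℕ}
    (T : Cor22.ThetaVolumeDatumAt (ratPoint q) l)
    (pp : Nat.Primes) (hp2 : (pp : ℕ) ≠ 2) (hp3 : (pp : ℕ) ≠ 3) (hp5 : (pp : ℕ) ≠ 5) (hpl : (pp : ℕ) ≠ l)
    (hlt : ∀ v : HeightOneSpectrum (𝓞 ℚ), Rat.HeightOneSpectrum.natGenerator v = pp → v.valuation ℚ q < 1)
    (hns : letI := T.instFieldF; letI := T.instAlgebraF; ¬ IsSquare (algebraMap (ratPoint q).F T.F q)) :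
    letI := T.instFieldF; letI := T.instNumberFieldF; letI := T.instAlgebraF; letI := T.instFieldK
    letI := T.instNumberFieldK; letI := T.instAlgebraK; letI := T.instFieldFbar; letI := T.instAlgebraFbar
    letI := T.instAlgebraKFbar; letI := T.instIsElliptic
    haveI : Fact (pp : ℕ).Prime := ⟨pp.2⟩
    ∀ x₀ : (thetaIndex (pilotDataOfK T.D T.K)).Fibre (.inr pp),
      absRamificationIdx (pp : ℕ) (kOf (pilotDataOfK T.D T.K) pp.1 x₀) ∣ 15 * l ∧
      ¬ (pp : ℕ) ∣ absRamificationIdx (pp : ℕ) (kOf (pilotDataOfK T.D T.K) pp.1 x₀) := by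
  -- adapted from abc-iut-w4-d087's `GenuineK.absRamificationIdx_kOf_dvd_fifteen_mul_ratPoint` (Cor312GenuineKLocalTypeFifteenRatPoint.lean)
  letI := T.instFieldF; letI := T.instNumberFieldF; letI := T.instAlgebraF; letI := T.instFieldK
  letI := T.instNumberFieldK; letI := T.instAlgebraK; letI := T.instFieldFbar; letI := T.instAlgebraFbar
  letI := T.instAlgebraKFbar; letI := T.instIsElliptic
  haveI : Fact (pp : ℕ).Prime := ⟨pp.2⟩
  set X := pilotDataOfK T.D T.K with hXdef
  intro x₀
  set w := placeOf X pp.1 x₀ with hwdef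
  have hpw : ((pp : ℕ) : 𝓞 T.K) ∈ w.asIdeal := natCast_mem_placeOf X pp.1 x₀
  have hwchar : residueChar T.K w = (pp : ℕ) := residueChar_eq_of_natCast_mem pp.1 hpw
  have hekOf : absRamificationIdx (pp : ℕ) (kOf X pp.1 x₀) = w.asIdeal.ramificationIdx ℤ := by
    rw [show absRamificationIdx (pp : ℕ) (kOf X pp.1 x₀) =
        absRamificationIdx (pp : ℕ) (RescaledCompletion T.K pp.1 (placeOf X pp.1 x₀) hpw) from rfl,
      absRamificationIdx_rescaledCompletion]
  have hnot : (pp : ℕ) ∉ ({2, 3, 5, l} : Finset ℕ) := by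
    simp only [Finset.mem_insert, Finset.mem_singleton, not_or]
    exact ⟨hp2, hp3, hp5, hpl⟩
  -- `q ≠ 0`: otherwise `0 ∈ T.F` is a square root of `q`; `q ≠ 1` from `|q|_p < 1`
  have hq0 : q ≠ 0 := by
    rintro rfl
    refine hns ⟨0, ?_⟩
    rw [mul_zero]
    exact map_zero _
  have hns' := forall_sq_ne_of_not_isSquare T hns
  -- `|q − 1|_p = 1` is an even power; the Legendre curve is multiplicative at `p` over `ℚ`
  have hev1 : ∀ v : HeightOneSpectrum (𝓞 ℚ), Rat.HeightOneSpectrum.natGenerator v = pp →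
      ∃ m : ℤ, v.valuation ℚ (q - 1) = WithZero.exp (2 * m) := by
    intro v hv
    have hla := hlt v hv
    refine ⟨0, ?_⟩
    rw [Valuation.map_sub_eq_of_lt_right _ (by rwa [Valuation.map_one]), Valuation.map_one, mul_zero, WithZero.exp_zero]
  have hmult : ∀ v : HeightOneSpectrum (𝓞 ℚ), Rat.HeightOneSpectrum.natGenerator v = pp →
      (⟨0, -(1 + q), 0, q, 0⟩ : WeierstrassCurve ℚ).HasMultiplicativeReductionAt v := by
    intro v hv
    have hla := hlt v hv
    have hq1 : q ≠ 1 := by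
      intro h; rw [h, Valuation.map_one] at hla; exact lt_irrefl _ hla
    haveI hE : (⟨0, -(1 + q), 0, q, 0⟩ : WeierstrassCurve ℚ).IsElliptic := (legendre_isElliptic_iff (by norm_num) q).mpr ⟨hq0, hq1⟩
    have h2 : v.valuation ℚ (2 : ℚ) = 1 := by
      have h := (UniformABCConjecture.valuation_natCast_eq_one_iff v 2).2 (fun hd => hp2
        (by rw [← hv]; exact ((Nat.prime_dvd_prime_iff_eq (Rat.HeightOneSpectrum.prime_natGenerator v) Nat.prime_two).1 hd)))
      exact_mod_cast h
    exact legendre_hasMultiplicativeReductionAt_of_valuation_lt_one v h2 hla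
  have hdvd : w.asIdeal.ramificationIdx ℤ ∣ 15 * l :=
    T.ramificationIdx_int_dvd_fifteen_mul_ratPoint_of_sq_ne hnot hmult (Or.inr hns') (Or.inl hev1) w hwchar
  rw [hekOf]
  refine ⟨hdvd, fun h => ?_⟩
  have h' : (pp : ℕ) ∣ 15 * l := h.trans hdvd
  have hl : l.Prime := T.D.l_prime
  rcases (Nat.Prime.dvd_mul pp.2).1 h' with h15 | hll
  · have h15' : (pp : ℕ) ∣ 3 * 5 := by norm_num; exact h15
    rcases (Nat.Prime.dvd_mul pp.2).1 h15' with h3' | h5'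
    · exact hp3 ((Nat.prime_dvd_prime_iff_eq pp.2 Nat.prime_three).1 h3')
    · exact hp5 ((Nat.prime_dvd_prime_iff_eq pp.2 Nat.prime_five).1 h5')
  · exact hpl ((Nat.prime_dvd_prime_iff_eq pp.2 hl).1 hll)

/-! ## §2. EXACT types: `e(K_{x₀}/ℚ_p) = 15·l` when `gcd(15, t) = 1` for the pole order `ord_p j(q) = −2t` -/

/-- **`p ∣ b`, EXACT: `e(K_{x₀}/ℚ_p) = 15·l`** at every fibre point over a rational pole `p ∉ {2, 3, 5, l}` of `j(q)` of order `2t`,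
`gcd(15, t) = 1`, with `|q|_p = 1` and no square root of `q − 1` in `T.F` — abc-iut-W-neg-2's two Kummer candidates
`GenuineK.absRamificationIdx_kOf_eq_fifteen_mul_or_eq_thirty_mul` (`{15·l, 30·l}`) cut down by §1 (`e ∣ 15·l`, `l > 0`).
[cite: Mochizuki2012, IUTchIV Thm. 1.10 p. 22 and proof Steps (ii)–(iii) p. 24–26] [cite: SerreLocalFields1979, Ch. IV §2 Cor. 1 of Prop. 7]
[claim: Mochizuki2012, status: disputed] -/
theorem GenuineK.absRamificationIdx_kOf_eq_fifteen_mul_of_sq_ne_sub_one {q : ℚ} {l : ℕ}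
    (T : Cor22.ThetaVolumeDatumAt (ratPoint q) l)
    (pp : Nat.Primes) (hp2 : (pp : ℕ) ≠ 2) (hp3 : (pp : ℕ) ≠ 3) (hp5 : (pp : ℕ) ≠ 5) (hpl : (pp : ℕ) ≠ l) {t : ℕ} (ht : 0 < t)
    (hpole : ∀ v : HeightOneSpectrum (𝓞 ℚ), Rat.HeightOneSpectrum.natGenerator v = pp →
      Literature.IUT.LogVolume.ord ℚ v (Cor22.jInv q) = -(2 * (t : ℤ)))
    (hcop : Nat.Coprime 15 t)
    (hunit : ∀ v : HeightOneSpectrum (𝓞 ℚ), Rat.HeightOneSpectrum.natGenerator v = pp → v.valuation ℚ q = 1)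
    (hns : letI := T.instFieldF; letI := T.instAlgebraF; ¬ IsSquare (algebraMap (ratPoint q).F T.F ((q - 1 : ℚ)))) :
    letI := T.instFieldF; letI := T.instNumberFieldF; letI := T.instAlgebraF; letI := T.instFieldK
    letI := T.instNumberFieldK; letI := T.instAlgebraK; letI := T.instFieldFbar; letI := T.instAlgebraFbar
    letI := T.instAlgebraKFbar; letI := T.instIsElliptic
    haveI : Fact (pp : ℕ).Prime := ⟨pp.2⟩
    ∀ x₀ : (thetaIndex (pilotDataOfK T.D T.K)).Fibre (.inr pp),
      absRamificationIdx (pp : ℕ) (kOf (pilotDataOfK T.D T.K) pp.1 x₀) = 15 * l := by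
  letI := T.instFieldF; letI := T.instNumberFieldF; letI := T.instAlgebraF; letI := T.instFieldK
  letI := T.instNumberFieldK; letI := T.instAlgebraK; letI := T.instFieldFbar; letI := T.instAlgebraFbar
  letI := T.instAlgebraKFbar; letI := T.instIsElliptic
  haveI : Fact (pp : ℕ).Prime := ⟨pp.2⟩
  intro x₀
  have hpole' : ∀ v : HeightOneSpectrum (𝓞 ℚ), Rat.HeightOneSpectrum.natGenerator v = pp →
      Literature.IUT.LogVolume.ord ℚ v (Cor22.jInv q) < 0 := by
    intro v hv
    rw [hpole v hv]
    have h0t : (0 : ℤ) < t := by exact_mod_cast ht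
    omega
  have hd := (GenuineK.absRamificationIdx_kOf_dvd_fifteen_mul_ratPoint_of_sq_ne_sub_one T pp hp2 hp3 hp5 hpl hpole' hunit hns x₀).1
  rcases GenuineK.absRamificationIdx_kOf_eq_fifteen_mul_or_eq_thirty_mul T pp hp2 hp3 hp5 hpl ht hpole hcop x₀ with h | h
  · exact h
  · exfalso
    rw [h] at hd
    have hl : 0 < l := T.D.l_prime.pos
    have := Nat.le_of_dvd (by omega) hd
    omega

/-- **`p ∣ a`, EXACT: `e(K_{x₀}/ℚ_p) = 15·l`** at every fibre point over a rational pole `p ∉ {2, 3, 5, l}` of `j(q)` of order `2t`,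
`gcd(15, t) = 1`, with `|q|_p < 1` and no square root of `q` in `T.F` (W-neg-2's dichotomy cut down by §1).
[cite: Mochizuki2012, IUTchIV Thm. 1.10 p. 22 and proof Steps (ii)–(iii) p. 24–26] [cite: SerreLocalFields1979, Ch. IV §2 Cor. 1 of Prop. 7]
[claim: Mochizuki2012, status: disputed] -/
theorem GenuineK.absRamificationIdx_kOf_eq_fifteen_mul_of_sq_ne {q : ℚ} {l : ℕ}
    (T : Cor22.ThetaVolumeDatumAt (ratPoint q) l)
    (pp : Nat.Primes) (hp2 : (pp : ℕ) ≠ 2) (hp3 : (pp : ℕ) ≠ 3) (hp5 : (pp : ℕ) ≠ 5) (hpl : (pp : ℕ) ≠ l) {t : ℕ} (ht : 0 < t)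
    (hpole : ∀ v : HeightOneSpectrum (𝓞 ℚ), Rat.HeightOneSpectrum.natGenerator v = pp →
      Literature.IUT.LogVolume.ord ℚ v (Cor22.jInv q) = -(2 * (t : ℤ)))
    (hcop : Nat.Coprime 15 t)
    (hlt : ∀ v : HeightOneSpectrum (𝓞 ℚ), Rat.HeightOneSpectrum.natGenerator v = pp → v.valuation ℚ q < 1)
    (hns : letI := T.instFieldF; letI := T.instAlgebraF; ¬ IsSquare (algebraMap (ratPoint q).F T.F q)) :
    letI := T.instFieldF; letI := T.instNumberFieldF; letI := T.instAlgebraF; letI := T.instFieldK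
    letI := T.instNumberFieldK; letI := T.instAlgebraK; letI := T.instFieldFbar; letI := T.instAlgebraFbar
    letI := T.instAlgebraKFbar; letI := T.instIsElliptic
    haveI : Fact (pp : ℕ).Prime := ⟨pp.2⟩
    ∀ x₀ : (thetaIndex (pilotDataOfK T.D T.K)).Fibre (.inr pp),
      absRamificationIdx (pp : ℕ) (kOf (pilotDataOfK T.D T.K) pp.1 x₀) = 15 * l := by
  letI := T.instFieldF; letI := T.instNumberFieldF; letI := T.instAlgebraF; letI := T.instFieldK
  letI := T.instNumberFieldK; letI := T.instAlgebraK; letI := T.instFieldFbar; letI := T.instAlgebraFbar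
  letI := T.instAlgebraKFbar; letI := T.instIsElliptic
  haveI : Fact (pp : ℕ).Prime := ⟨pp.2⟩
  intro x₀
  have hd := (GenuineK.absRamificationIdx_kOf_dvd_fifteen_mul_ratPoint_of_sq_ne T pp hp2 hp3 hp5 hpl hlt hns x₀).1
  rcases GenuineK.absRamificationIdx_kOf_eq_fifteen_mul_or_eq_thirty_mul T pp hp2 hp3 hp5 hpl ht hpole hcop x₀ with h | h
  · exact h
  · exfalso
    rw [h] at hd
    have hl : 0 < l := T.D.l_prime.pos
    have := Nat.le_of_dvd (by omega) hd
    omega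

end Summit.ABC.IUTFork.Conditional

end
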